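import Summits.BirchSwinnertonDyer.BirchSwinnertonDyer.Theorems.ClassRecordThreeEulerHalvesAtThreeCartanTorusCubeCutTori
import Mathlib.RingTheory.AdjoinRoot
import Mathlib.RingTheory.IntegralDomain
import Mathlib.Algebra.Polynomial.SpecificDegree
import Mathlib.Algebra.Polynomial.Degree.SmallDegree
import Mathlib.GroupTheory.SpecificGroups.Cyclic.Basic
import HarnessLib

/-!
# Crux 19109 `EulerHalvesAtThree` ∕ 23422 line `cartan` v8′, stub (F2a): the TORUS-CUBE CUT of S-K1′ — the non-split torus is CYCLIC;
# (T) clause 3 `3·|T_C³| = (q − 1)(q + 1)` and the input `P_torusCard` (proved)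

Seat `bsd-stepL-tam3-p1` g21 (LINE OWNER of crux 23422; `--supports stmt-BirchSwinnertonDyer-23422 --as helper`). CONTENT, all PROVED:
* §0 cubes in a finite cyclic group of order divisible by `3`: `x` is a cube iff `x ^ (|G|/3) = 1` (`cyclic_cube_iff`), and the cubes
  number `|G|/3` (`cyclic_card_cubes`) — generator bookkeeping only;
* §1 the non-split torus `T_C` = centraliser of `η` as a `Subgroup` (`torusSubgroup`; `nonsplitTorus η` is its underlying `Finset`),
  the coordinates `(a,t)` of `g = a·1 + t·η ∈ T_C` (`coord`, inverse to `lin` of `…CartanTorusCubeCutTori`), the multiplication law in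
  coordinates (`lin_mul_lin`, Cayley–Hamilton for `2 × 2` matrices);
* §2 `𝔽_q[η] ≅ 𝔽_q[X]/(X² − tr η·X + det η)` (`torusPoly`, IRREDUCIBLE for `η` without rational eigenvalue, so `AdjoinRoot` is a field)
  and the injective monoid hom `T_C →* 𝔽_q[X]/(torusPoly)` (`psi`), whence `T_C` is CYCLIC (`torusSubgroup_isCyclic`: a finite
  subgroup of the units of an integral domain) of order `(q−1)(q+1)` (`card_torusSubgroup`);
* §3 transport to the `Finset`s of the frame: `t ∈ T_C` is a cube iff `t^{(q²−1)/3} = 1` (`mem_nonsplitCubes_iff`), **(T) clause 3**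
  `3·|nonsplitCubes η| = (q−1)(q+1)` (`nonsplitCubes_card`), and the input **`P_torusCard` of the cut, PROVED** (`torusCard`) from it and
  bsd-idea-10 g11's `splitTorus_card` ∕ `nonsplitTorus_card`.
HONEST FRAMING: elementary finite-group ∕ finite-field facts about `GL₂(𝔽_q)`; nothing about any curve, `L`-value or period; S-K1′ is
NOT proved here (five inputs of the cut remain); no summit statement, no route item and no registered stub is proved; BSD is proved for no
curve. [folklore; background: cite: Bump1997, §4.1]
-/

namespace Summit.BirchSwinnertonDyer.BirchSwinnertonDyer.Theorems.CartanTorusCubeCut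

open Summit.BirchSwinnertonDyer.BirchSwinnertonDyer.Theorems.CartanDegree Polynomial

set_option linter.dupNamespace false
set_option autoImplicit false

noncomputable section

/-! ### §0 Cubes in a finite cyclic group -/

section Cyclic

variable {α : Type*} [Group α] [Fintype α] [DecidableEq α] [IsCyclic α]

omit [DecidableEq α] in
/-- In a finite cyclic group of order divisible by `3`, `x` is a cube iff `x ^ (|α| / 3) = 1`. [folklore] -/
theorem cyclic_cube_iff (h3 : 3 ∣ Fintype.card α) (x : α) :
    (∃ y : α, y ^ 3 = x) ↔ x ^ (Fintype.card α / 3) = 1 := by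
  obtain ⟨g, hg⟩ := IsCyclic.exists_monoid_generator (α := α)
  have hord : orderOf g = Fintype.card α := by
    rw [orderOf_eq_card_of_forall_mem_powers hg, Nat.card_eq_fintype_card]
  obtain ⟨m, hm⟩ := h3
  have hm0 : 0 < m := by
    rcases Nat.eq_zero_or_pos m with h | h
    · exfalso; rw [h, mul_zero] at hm; exact Fintype.card_ne_zero hm
    · exact h
  have hdiv : Fintype.card α / 3 = m := by rw [hm, Nat.mul_div_cancel_left m (by norm_num)]
  rw [hdiv]
  constructor
  · rintro ⟨y, rfl⟩
    rw [← pow_mul, (by rw [hm] : 3 * m = Fintype.card α)]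
    exact pow_card_eq_one
  · intro hx
    obtain ⟨k, rfl⟩ := (Submonoid.mem_powers_iff _ _).1 (hg x)
    rw [← pow_mul] at hx
    have hdvd : orderOf g ∣ k * m := orderOf_dvd_of_pow_eq_one hx
    rw [hord, hm] at hdvd
    have h3k : 3 ∣ k := by
      rw [mul_comm k m, mul_comm 3 m] at hdvd
      exact Nat.dvd_of_mul_dvd_mul_left hm0 hdvd
    obtain ⟨j, rfl⟩ := h3k
    exact ⟨g ^ j, by rw [← pow_mul, mul_comm]⟩

/-- In a finite cyclic group of order divisible by `3`, the cubes number `|α| / 3`. [folklore] -/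
theorem cyclic_card_cubes (h3 : 3 ∣ Fintype.card α) :
    3 * (Finset.univ.image (fun y : α => y ^ 3)).card = Fintype.card α := by
  obtain ⟨g, hg⟩ := IsCyclic.exists_monoid_generator (α := α)
  have hord : orderOf g = Fintype.card α := by
    rw [orderOf_eq_card_of_forall_mem_powers hg, Nat.card_eq_fintype_card]
  obtain ⟨m, hm⟩ := h3
  have hm0 : 0 < m := by
    rcases Nat.eq_zero_or_pos m with h | h
    · exfalso; rw [h, mul_zero] at hm; exact Fintype.card_ne_zero hm
    · exact h
  have hg3m : g ^ (3 * m) = 1 := by rw [← hm]; exact pow_card_eq_one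
  have himg : Finset.univ.image (fun y : α => y ^ 3) = (Finset.range m).image (fun j => g ^ (3 * j)) := by
    ext x
    simp only [Finset.mem_image, Finset.mem_univ, true_and, Finset.mem_range]
    constructor
    · rintro ⟨y, rfl⟩
      obtain ⟨k, rfl⟩ := (Submonoid.mem_powers_iff _ _).1 (hg y)
      refine ⟨k % m, Nat.mod_lt _ hm0, ?_⟩
      rw [← pow_mul]
      have h1 := Nat.mod_add_div k m
      have e : k * 3 = 3 * (k % m) + (3 * m) * (k / m) := by
        calc k * 3 = (k % m + m * (k / m)) * 3 := by rw [h1]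
          _ = 3 * (k % m) + (3 * m) * (k / m) := by ring
      rw [e, pow_add, show g ^ (3 * m * (k / m)) = 1 by rw [pow_mul, hg3m, one_pow], mul_one]
    · rintro ⟨j, -, rfl⟩
      exact ⟨g ^ j, by rw [← pow_mul, mul_comm]⟩
  rw [himg, Finset.card_image_of_injOn, Finset.card_range, hm]
  intro i hi j hj hij
  simp only [Finset.coe_range, Set.mem_Iio] at hi hj
  have hi' : 3 * i ∈ Set.Iio (orderOf g) := by rw [Set.mem_Iio, hord, hm]; omega
  have hj' : 3 * j ∈ Set.Iio (orderOf g) := by rw [Set.mem_Iio, hord, hm]; omega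
  have := pow_injOn_Iio_orderOf hi' hj' hij
  omega

end Cyclic

variable {q : ℕ} [Fact q.Prime]

/-! ### §1 The non-split torus as a subgroup; coordinates; the multiplication law -/

/-- the non-split torus `T_C` (centraliser of `η`) as a subgroup of `GL₂(𝔽_q)`. -/
def torusSubgroup (η : Mat q) : Subgroup (G q) where
  carrier := {g | (g : Mat q) * η = η * g}
  mul_mem' := by
    intro a b ha hb
    simp only [Set.mem_setOf_eq] at ha hb ⊢
    rw [Units.val_mul, mul_assoc, hb, ← mul_assoc, ha, mul_assoc]
  one_mem' := by simp
  inv_mem' := by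
    intro a ha
    simp only [Set.mem_setOf_eq] at ha ⊢
    have h1 : ((a⁻¹ : G q) : Mat q) * (a : Mat q) = 1 := by
      rw [← Units.val_mul, inv_mul_cancel, Units.val_one]
    have h2 : (a : Mat q) * ((a⁻¹ : G q) : Mat q) = 1 := by
      rw [← Units.val_mul, mul_inv_cancel, Units.val_one]
    calc ((a⁻¹ : G q) : Mat q) * η
        = ((a⁻¹ : G q) : Mat q) * η * ((a : Mat q) * ((a⁻¹ : G q) : Mat q)) := by rw [h2, mul_one]
      _ = ((a⁻¹ : G q) : Mat q) * (η * (a : Mat q)) * ((a⁻¹ : G q) : Mat q) := by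
          simp only [mul_assoc]
      _ = ((a⁻¹ : G q) : Mat q) * ((a : Mat q) * η) * ((a⁻¹ : G q) : Mat q) := by rw [ha]
      _ = η * ((a⁻¹ : G q) : Mat q) := by rw [← mul_assoc, h1, one_mul]

/-- membership in `torusSubgroup η` is commuting with `η`. -/
theorem mem_torusSubgroup {η : Mat q} {g : G q} :
    g ∈ torusSubgroup η ↔ (g : Mat q) * η = η * g := Iff.rfl

/-- the frame's `Finset` `nonsplitTorus η` is the set of elements of `torusSubgroup η`. -/
theorem mem_nonsplitTorus_iff {η : Mat q} {g : G q} : g ∈ nonsplitTorus η ↔ g ∈ torusSubgroup η := by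
  simp [nonsplitTorus, mem_torusSubgroup]

/-- the coordinates `(a, t)` of a matrix `g = a·1 + t·η` (read off the first row; `η 0 1 ≠ 0`). -/
def coord (η : Mat q) (g : Mat q) : ZMod q × ZMod q :=
  (g 0 0 - g 0 1 * (η 0 1)⁻¹ * η 0 0, g 0 1 * (η 0 1)⁻¹)

/-- `coord` inverts `lin`. -/
theorem coord_lin {η : Mat q} (hη : ¬ HasRatEigenvalue η) (p : ZMod q × ZMod q) :
    coord η (lin η p) = p := by
  have hf := entry01_ne_zero hη
  simp only [coord, lin, Matrix.add_apply, Matrix.smul_apply, Matrix.one_apply_eq,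
    Matrix.one_apply_ne (by decide : (0 : Fin 2) ≠ 1), smul_eq_mul, mul_zero, zero_add, mul_one]
  ext
  · simp only
    rw [mul_assoc p.2, mul_inv_cancel₀ hf]; ring
  · simp only
    rw [mul_assoc, mul_inv_cancel₀ hf, mul_one]

/-- an element of the torus is `lin` of its coordinates. -/
theorem lin_coord_of_mem {η : Mat q} (hη : ¬ HasRatEigenvalue η) {g : G q} (hg : g ∈ torusSubgroup η) :
    lin η (coord η (g : Mat q)) = (g : Mat q) := by
  have hg' : g ∈ nonsplitTorus η := mem_nonsplitTorus_iff.2 hg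
  rw [nonsplitTorus_eq_image hη, Finset.mem_image] at hg'
  obtain ⟨p, hp, rfl⟩ := hg'
  have hp0 : p ≠ 0 := (Finset.mem_erase.1 hp).1
  rw [linGL_coe hη hp0, coord_lin hη]

/-- multiplication in coordinates: `(a,t)·(a',t') = (aa' − tt'·det η, at' + a't + tt'·tr η)`. -/
def pmul (η : Mat q) (p p' : ZMod q × ZMod q) : ZMod q × ZMod q :=
  (p.1 * p'.1 - p.2 * p'.2 * η.det, p.1 * p'.2 + p.2 * p'.1 + p.2 * p'.2 * η.trace)

/-- `lin` is multiplicative for `pmul` (Cayley–Hamilton `η² = tr η·η − det η·1`). -/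
theorem lin_mul_lin (η : Mat q) (p p' : ZMod q × ZMod q) :
    lin η p * lin η p' = lin η (pmul η p p') := by
  ext i j
  fin_cases i <;> fin_cases j <;>
    simp [lin, pmul, Matrix.mul_apply, Fin.sum_univ_two, Matrix.det_fin_two, Matrix.trace_fin_two,
      Matrix.one_apply] <;> ring

/-- `coord 1 = (1, 0)`. -/
theorem coord_one (η : Mat q) : coord η (1 : Mat q) = (1, 0) := by
  simp [coord, Matrix.one_apply_ne (by decide : (0 : Fin 2) ≠ 1)]

/-! ### §2 `𝔽_q[η]` as `AdjoinRoot (X² − tr η·X + det η)`; the torus is cyclic -/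

/-- the characteristic polynomial `X² − tr η·X + det η` of `η`, as a quadratic. -/
def torusPoly (η : Mat q) : (ZMod q)[X] := C 1 * X ^ 2 + C (-η.trace) * X + C η.det

/-- `torusPoly η` has degree `2`. -/
theorem natDegree_torusPoly (η : Mat q) : (torusPoly η).natDegree = 2 :=
  natDegree_quadratic one_ne_zero

/-- evaluation of `torusPoly`. -/
theorem eval_torusPoly (η : Mat q) (x : ZMod q) :
    (torusPoly η).eval x = x * x - η.trace * x + η.det := by
  simp only [torusPoly, eval_add, eval_mul, eval_C, eval_pow, eval_X]
  ring

/-- `torusPoly η` has no root when `η` has no rational eigenvalue. -/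
theorem not_isRoot_torusPoly {η : Mat q} (hη : ¬ HasRatEigenvalue η) (x : ZMod q) :
    ¬ (torusPoly η).IsRoot x := by
  intro h
  apply hη
  refine ⟨x, ?_⟩
  rw [IsRoot, eval_torusPoly] at h
  linear_combination h

/-- `torusPoly η` is irreducible when `η` has no rational eigenvalue. -/
theorem irreducible_torusPoly {η : Mat q} (hη : ¬ HasRatEigenvalue η) : Irreducible (torusPoly η) :=
  irreducible_of_degree_le_three_of_not_isRoot (by rw [natDegree_torusPoly]; decide)
    (not_isRoot_torusPoly hη)

/-- the field `𝔽_q[X]/(torusPoly η) ≅ 𝔽_q[η] ≅ 𝔽_{q²}`. -/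
abbrev Kη (η : Mat q) : Type := AdjoinRoot (torusPoly η)

/-- `a + t·θ` in `𝔽_q[X]/(torusPoly η)`, `θ` the class of `X`. -/
def ofPair (η : Mat q) (p : ZMod q × ZMod q) : Kη η :=
  AdjoinRoot.of (torusPoly η) p.1 + AdjoinRoot.of (torusPoly η) p.2 * AdjoinRoot.root (torusPoly η)

/-- `θ² = tr η·θ − det η`. -/
theorem root_mul_root (η : Mat q) :
    AdjoinRoot.root (torusPoly η) * AdjoinRoot.root (torusPoly η) =
      AdjoinRoot.of (torusPoly η) η.trace * AdjoinRoot.root (torusPoly η) - AdjoinRoot.of (torusPoly η) η.det := by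
  have h : aeval (AdjoinRoot.root (torusPoly η)) (C 1 * X ^ 2 + C (-η.trace) * X + C η.det) = 0 :=
    (by rw [AdjoinRoot.aeval_eq, AdjoinRoot.mk_self] : aeval (AdjoinRoot.root (torusPoly η)) (torusPoly η) = 0)
  simp only [map_add, map_mul, map_neg, aeval_C, aeval_X, map_pow, map_one, one_mul,
    AdjoinRoot.algebraMap_eq] at h
  linear_combination h

/-- `ofPair` is multiplicative for `pmul`. -/
theorem ofPair_mul (η : Mat q) (p p' : ZMod q × ZMod q) :
    ofPair η p * ofPair η p' = ofPair η (pmul η p p') := by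
  have h := root_mul_root η
  simp only [ofPair, pmul, map_sub, map_add, map_mul]
  linear_combination (AdjoinRoot.of (torusPoly η) p.2 * AdjoinRoot.of (torusPoly η) p'.2) * h

/-- `ofPair (1, 0) = 1`. -/
theorem ofPair_one_zero (η : Mat q) : ofPair η (1, 0) = 1 := by
  simp [ofPair]

/-- `of : 𝔽_q → 𝔽_q[X]/(torusPoly η)` is injective. -/
theorem of_torusPoly_injective (η : Mat q) : Function.Injective (AdjoinRoot.of (torusPoly η)) := by
  apply AdjoinRoot.of.injective_of_degree_ne_zero
  rw [degree_eq_natDegree (irreducible_torusPoly_aux η), natDegree_torusPoly]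
  · decide
where
  /-- `torusPoly η ≠ 0`. -/
  irreducible_torusPoly_aux (η : Mat q) : torusPoly η ≠ 0 := by
    intro h
    have := natDegree_torusPoly η
    rw [h, natDegree_zero] at this
    exact absurd this (by decide)

/-- `ofPair` is injective when `η` has no rational eigenvalue (`1, θ` are linearly independent). -/
theorem ofPair_injective {η : Mat q} (hη : ¬ HasRatEigenvalue η) : Function.Injective (ofPair η) := by
  haveI : Fact (Irreducible (torusPoly η)) := ⟨irreducible_torusPoly hη⟩
  have hinj := of_torusPoly_injective η
  intro p p' h
  simp only [ofPair] at h
  have h0 : AdjoinRoot.of (torusPoly η) (p.1 - p'.1) +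
      AdjoinRoot.of (torusPoly η) (p.2 - p'.2) * AdjoinRoot.root (torusPoly η) = 0 := by
    rw [map_sub, map_sub]
    linear_combination h
  by_cases ht : p.2 = p'.2
  · rw [ht, sub_self, map_zero, zero_mul, add_zero, ← map_zero (AdjoinRoot.of (torusPoly η))] at h0
    exact Prod.ext (sub_eq_zero.1 (hinj h0)) ht
  · exfalso
    have hne : AdjoinRoot.of (torusPoly η) (p.2 - p'.2) ≠ 0 :=
      (map_ne_zero_iff _ hinj).2 (sub_ne_zero.2 ht)
    set c : ZMod q := -(p.1 - p'.1) * (p.2 - p'.2)⁻¹ with hc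
    have hroot : AdjoinRoot.root (torusPoly η) = AdjoinRoot.of (torusPoly η) c := by
      rw [hc, map_mul, map_neg, map_inv₀]
      field_simp
      linear_combination h0
    have h2 := AdjoinRoot.eval₂_root (torusPoly η)
    rw [hroot, eval₂_hom, ← map_zero (AdjoinRoot.of (torusPoly η))] at h2
    exact not_isRoot_torusPoly hη c (hinj h2)

/-- the coordinate hom `T_C →* 𝔽_q[X]/(torusPoly η)`, `g = a·1 + t·η ↦ a + t·θ`. -/
def psi (η : Mat q) (hη : ¬ HasRatEigenvalue η) : ↥(torusSubgroup η) →* Kη η where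
  toFun g := ofPair η (coord η ((g : G q) : Mat q))
  map_one' := by
    show ofPair η (coord η (((1 : ↥(torusSubgroup η)) : G q) : Mat q)) = 1
    rw [OneMemClass.coe_one, Units.val_one, coord_one, ofPair_one_zero]
  map_mul' g h := by
    have hg := lin_coord_of_mem hη g.2
    have hh := lin_coord_of_mem hη h.2
    have hmul : (((g * h : ↥(torusSubgroup η)) : G q) : Mat q) =
        lin η (pmul η (coord η ((g : G q) : Mat q)) (coord η ((h : G q) : Mat q))) := by
      rw [Subgroup.coe_mul, Units.val_mul, ← lin_mul_lin, hg, hh]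
    show ofPair η (coord η (((g * h : ↥(torusSubgroup η)) : G q) : Mat q)) =
      ofPair η (coord η ((g : G q) : Mat q)) * ofPair η (coord η ((h : G q) : Mat q))
    rw [hmul, coord_lin hη, ofPair_mul]

/-- `psi` is injective. -/
theorem psi_injective {η : Mat q} (hη : ¬ HasRatEigenvalue η) : Function.Injective (psi η hη) := by
  intro g h hgh
  have h1 : coord η ((g : G q) : Mat q) = coord η ((h : G q) : Mat q) := ofPair_injective hη hgh
  apply Subtype.ext
  apply Units.ext
  rw [← lin_coord_of_mem hη g.2, ← lin_coord_of_mem hη h.2, h1]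

/-- **The non-split torus is cyclic** (`T_C ↪ (𝔽_q[X]/(torusPoly η))ˣ`, a finite subgroup of the units of a field). -/
theorem torusSubgroup_isCyclic {η : Mat q} (hη : ¬ HasRatEigenvalue η) : IsCyclic ↥(torusSubgroup η) := by
  haveI : Fact (Irreducible (torusPoly η)) := ⟨irreducible_torusPoly hη⟩
  exact isCyclic_of_injective_ringHom (psi η hη) (psi_injective hη)

/-- `|T_C| = (q − 1)(q + 1)` for the subgroup (bsd-idea-10 g11's `nonsplitTorus_card`). -/
theorem card_torusSubgroup {η : Mat q} (hη : ¬ HasRatEigenvalue η) [Fintype ↥(torusSubgroup η)] :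
    Fintype.card ↥(torusSubgroup η) = (q - 1) * (q + 1) := by
  classical
  rw [← nonsplitTorus_card hη, Fintype.card_subtype]
  congr 1
  ext g
  simp [mem_nonsplitTorus_iff]

/-! ### §3 Transport to the frame's `Finset`s: cubes, (T) clause 3, `P_torusCard` -/

/-- `3 ∣ (q − 1)(q + 1)` for a prime `q ≥ 5`. -/
theorem three_dvd_torus_order (hq5 : 5 ≤ q) : 3 ∣ (q - 1) * (q + 1) := by
  have hq : q.Prime := Fact.out
  have h3 : ¬ 3 ∣ q := fun h => by
    have := (Nat.prime_dvd_prime_iff_eq Nat.prime_three hq).1 h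
    omega
  have : q % 3 = 1 ∨ q % 3 = 2 := by omega
  rcases this with h | h
  · exact Dvd.dvd.mul_right (by omega) _
  · exact Dvd.dvd.mul_left (by omega) _

/-- the cubes of the torus are the image of cubing on the subgroup. -/
theorem nonsplitCubes_eq_map (η : Mat q) [Fintype ↥(torusSubgroup η)] [DecidableEq ↥(torusSubgroup η)] :
    nonsplitCubes η = (Finset.univ.image (fun y : ↥(torusSubgroup η) => y ^ 3)).map
      ⟨(fun y : ↥(torusSubgroup η) => (y : G q)), Subtype.val_injective⟩ := by
  ext t
  simp only [nonsplitCubes, Finset.mem_image, Finset.mem_map, Finset.mem_univ, true_and,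
    Function.Embedding.coeFn_mk]
  constructor
  · rintro ⟨s, hs, rfl⟩
    exact ⟨⟨s, mem_nonsplitTorus_iff.1 hs⟩ ^ 3, ⟨⟨s, mem_nonsplitTorus_iff.1 hs⟩, rfl⟩, rfl⟩
  · rintro ⟨y, ⟨z, rfl⟩, rfl⟩
    exact ⟨(z : G q), mem_nonsplitTorus_iff.2 z.2, rfl⟩

/-- **(T), third clause, PROVED**: `3·|T_C³| = (q − 1)(q + 1)` for `η` without rational eigenvalue, `q ≥ 5`. -/
theorem nonsplitCubes_card {η : Mat q} (hη : ¬ HasRatEigenvalue η) (hq5 : 5 ≤ q) :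
    3 * (nonsplitCubes η).card = (q - 1) * (q + 1) := by
  classical
  haveI := torusSubgroup_isCyclic hη
  have hcard := card_torusSubgroup hη
  have h3 : 3 ∣ Fintype.card ↥(torusSubgroup η) := by rw [hcard]; exact three_dvd_torus_order hq5
  rw [nonsplitCubes_eq_map, Finset.card_map, cyclic_card_cubes h3, hcard]

/-- **cubes = kernel of the `(q² − 1)/3`-th power**: `t ∈ T_C` is a cube iff `t ^ ((q−1)(q+1)/3) = 1`. -/
theorem mem_nonsplitCubes_iff {η : Mat q} (hη : ¬ HasRatEigenvalue η) (hq5 : 5 ≤ q) {t : G q}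
    (ht : t ∈ nonsplitTorus η) :
    t ∈ nonsplitCubes η ↔ (t : Mat q) ^ ((q - 1) * (q + 1) / 3) = 1 := by
  classical
  haveI := torusSubgroup_isCyclic hη
  have hcard := card_torusSubgroup hη
  have h3 : 3 ∣ Fintype.card ↥(torusSubgroup η) := by rw [hcard]; exact three_dvd_torus_order hq5
  have key := cyclic_cube_iff h3 (⟨t, mem_nonsplitTorus_iff.1 ht⟩ : ↥(torusSubgroup η))
  rw [hcard] at key
  rw [nonsplitCubes_eq_map, Finset.mem_map]
  constructor
  · rintro ⟨y, hy, hyt⟩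
    rw [Finset.mem_image] at hy
    obtain ⟨z, -, rfl⟩ := hy
    have hz : (⟨t, mem_nonsplitTorus_iff.1 ht⟩ : ↥(torusSubgroup η)) = z ^ 3 := by
      apply Subtype.ext; exact hyt.symm
    have := key.1 ⟨z, hz.symm⟩
    have := congrArg (fun y : ↥(torusSubgroup η) => ((y : G q) : Mat q)) this
    simpa [Units.val_pow_eq_pow_val] using this
  · intro h
    have h' : (⟨t, mem_nonsplitTorus_iff.1 ht⟩ : ↥(torusSubgroup η)) ^ ((q - 1) * (q + 1) / 3) = 1 := by
      apply Subtype.ext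
      apply Units.ext
      simpa [Units.val_pow_eq_pow_val] using h
    obtain ⟨y, hy⟩ := key.2 h'
    refine ⟨y ^ 3, Finset.mem_image.2 ⟨y, Finset.mem_univ _, rfl⟩, ?_⟩
    simpa using congrArg (fun y : ↥(torusSubgroup η) => (y : G q)) hy

/-- **Input (T) of the torus-cube cut, PROVED** (the body of `P_torusCard` of `Lines/cartan_sk1.lean`, verbatim): for a prime `q ≥ 5`
and `η` without rational eigenvalue, `|T_s| = (q−1)²`, `|T_C| = (q−1)(q+1)`, `3·|T_C³| = (q−1)(q+1)`. -/
theorem torusCard : ∀ (q : ℕ) [Fact q.Prime], 5 ≤ q → ∀ (η : Mat q), ¬ HasRatEigenvalue η →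
    (splitTorus q).card = (q - 1) ^ 2 ∧ (nonsplitTorus η).card = (q - 1) * (q + 1) ∧
    3 * (nonsplitCubes η).card = (q - 1) * (q + 1) := by
  intro q _ hq5 η hη
  exact ⟨splitTorus_card, nonsplitTorus_card hη, nonsplitCubes_card hη hq5⟩

end

end Summit.BirchSwinnertonDyer.BirchSwinnertonDyer.Theorems.CartanTorusCubeCut
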